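import Literature.AnabelianGeometry.EtaleTheta.ConstantMultipleRigidity
import Literature.AnabelianGeometry.EtaleTheta.Thm16SubdagStatements
import HarnessLib

/-!
# [EtTh] §1 Def. 1.7 / §2: C-level data for the tempered fundamental group `Π^tp_C` of the §1 model
# — the open embedding `Π^tp_X ⊆ Π^tp_C` and the augmentation `Π^tp_C ↠ G_K` (parameter record)

Mochizuki, *The étale theta function and its Frobenioid-theoretic manifestations*, Publ. RIMS **45**
(2009), §1 Def. 1.7, PRIMS PDF p. 27 (printed 253): "(II) the hyperbolic curve determined by `X^log` is
not arithmetic over `K` … the stack-theoretic quotient of `X^log` by the natural action of `±1`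
`X^log → C^log` … `Π^tp_C`", and §2 p. 36 (printed 262): "`Π_X ⊆ Π_C` for the respective (profinite)
étale fundamental groups … `1 → Δ_X → Π_X → G_K → 1`, `Δ_C := Ker(Π_C ↠ G_K)`, `Gal(X/C) ≅ ℤ/2ℤ`"
[cite: MochizukiEtTh2009, Def 1.7 p.27].

Cell abc-iut, layer L2, W3-L2-02 («§2 COVER/ORBIT MODEL», seat abc-iut-L2-d3), phase-2 precursor: a
PARAMETER RECORD over abc-iut-L2-t1's `MuTwoSetting` (`ConstantMultipleRigidity.lean`: `Π^tp_C = GtpC`,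
`inclX : Π^tp_X →* Π^tp_C` continuous, injective, of open normal range of index `2`; the representatives
`ε_μ`, `ε_±`; `dotX`, `dotC`) carrying the two printed C-level data that structure does not record —
census memo HOME/…/W3-L2-02-CENSUS.md input P-C2, and the «CoreTower NV-BLOCKED needs list (i)» of
abc-iut-w5-d052: "`MuTwoSetting` lacks «`inclX` is an open embedding» … and lacks «`Π^tp_C ↠ G_K`
extending `aug`»". Same pattern as abc-iut-L2-t7's `ThetaSetting.OncePuncturedData` (ruling η′:
parameters, never named facts): `MuTwoSetting.CLevelData M` has the fields

* `isOpenEmbedding_inclX` — `Π^tp_X → Π^tp_C` is an OPEN EMBEDDING (it is the inclusion of the open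
  subgroup of the double covering `X^log → C^log`, p. 27); `MuTwoSetting` records continuity, injectivity
  and openness of the range, not that the topology of `Π^tp_X` is the subspace topology;
* `augC`, `augC_inclX`, `range_augC` — the augmentation `Π^tp_C → G_{ℚ_p}` of image `G_K` extending
  `aug : Π^tp_X → G_{ℚ_p}` ("`Δ_C := Ker(Π_C ↠ G_K)`", p. 36; `C^log` is a curve over `K`).

PROVED from them: inner automorphisms of `Π^tp_C` restrict to TOPOLOGICAL automorphisms of `Π^tp_X`
(`conjX` — the continuity source for the "extends to `Π^tp_C`" transports of Prop. 1.8 / 2.4 / 2.6 and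
for the L6 `CoreTower.isoXbarbar`), with `aug (conjX g x) = augC g · aug x · (augC g)⁻¹`; `Δ^tp_X` is
stable; there is a GEOMETRIC element of `Π^tp_C ∖ Π^tp_X` (an inversion, p. 36 "`ι ∈ Δ_C`" lifting the
nontrivial element of `Gal(X/C)`); and — input P-C7 of the census REDUCED to abc-iut-L6-d5's L02 binder
`Thm16Sub.KerToZIsCompactlyGenerated` ("`Π^tp_Y` is topologically generated by the compact subgroups",
the printed DEFINITION of `Z`, p. 12) — `Π^tp_Y` is NORMAL in `Π^tp_C` ("`Gal(Y/C)`", p. 46).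
Nothing here asserts that such data exist for an actual curve; no instance; no new named `Prop` fact;
no side is taken on [IUTchIII] Cor. 3.12; typed ≠ proved.
-/

noncomputable section

namespace Literature.AnabelianGeometry.EtaleTheta

open Literature.AnabelianGeometry.SemiGraphs
open _root_.Topology

variable {p : ℕ} [Fact p.Prime]

namespace MuTwoSetting

/-- **C-level data for `Π^tp_C`** over a `MuTwoSetting` (Def. 1.7, p. 27; §2 p. 36): the inclusion
`Π^tp_X ↪ Π^tp_C` is an open embedding, and `Π^tp_C` carries an augmentation to `G_{ℚ_p}` with image
`G_K` extending that of `Π^tp_X` ("`1 → Δ_C → Π_C → G_K → 1`"). A PARAMETER record (what the §1 typing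
does not carry), never asserted to be inhabited. [cite: MochizukiEtTh2009, Def 1.7 p.27] -/
structure CLevelData (M : MuTwoSetting p) : Type where
  /-- `Π^tp_X → Π^tp_C` is an open embedding (the open subgroup of the double covering `X → C`, p. 27). -/
  isOpenEmbedding_inclX : IsOpenEmbedding M.inclX
  /-- The augmentation `Π^tp_C → G_{ℚ_p}` of the orbicurve `C^log` over `K` (p. 27; "`Π_C ↠ G_K`", p. 36). -/
  augC : M.GtpC →ₜ* GQp p
  /-- It extends the augmentation of `Π^tp_X`: `augC ∘ inclX = aug` (`X^log → C^log` is a morphism over `K`). -/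
  augC_inclX : ∀ g : M.PiTemp, augC (M.inclX g) = M.aug g
  /-- Its image is `G_K` ("`1 → Δ_C → Π_C → G_K → 1`", p. 36: `C^log` is geometrically connected over `K`). -/
  range_augC : augC.toMonoidHom.range = M.GK

namespace CLevelData

variable {M : MuTwoSetting p}

/-! ### `Π^tp_X` as a topological subgroup of `Π^tp_C`: inner automorphisms restrict continuously -/

/-- The inverse of `Π^tp_X ≃ inclX(Π^tp_X)` is continuous (`inclX` is an embedding).
[cite: MochizukiEtTh2009, Def 1.7 p.27] -/
theorem continuous_ofInjective_symm (e : M.CLevelData) :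
    Continuous (MonoidHom.ofInjective M.injective_inclX).symm := by
  rw [e.isOpenEmbedding_inclX.isEmbedding.continuous_iff]
  have h : (M.inclX ∘ (MonoidHom.ofInjective M.injective_inclX).symm) =
      (Subtype.val : M.inclX.range → M.GtpC) :=
    funext fun x => MonoidHom.apply_ofInjective_symm M.injective_inclX x
  rw [h]
  exact continuous_subtype_val

/-- `g · inclX(x) · g⁻¹ ∈ inclX(Π^tp_X)` (`Π^tp_X ⊴ Π^tp_C`, field `range_inclX_normal`).
[cite: MochizukiEtTh2009, Def 1.7 p.27] -/
theorem conj_inclX_mem_range (g : M.GtpC) (x : M.PiTemp) : g * M.inclX x * g⁻¹ ∈ M.inclX.range :=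
  M.range_inclX_normal.conj_mem _ ⟨x, rfl⟩ g

/-- The inner automorphism of `Π^tp_C` by `g`, restricted to `Π^tp_X`, as a bare function
(`inclX⁻¹(g · inclX(x) · g⁻¹)`). [cite: MochizukiEtTh2009, Prop 1.8 p.28] -/
def conjFun (g : M.GtpC) (x : M.PiTemp) : M.PiTemp :=
  (MonoidHom.ofInjective M.injective_inclX).symm ⟨g * M.inclX x * g⁻¹, conj_inclX_mem_range g x⟩

/-- `inclX (conjFun g x) = g · inclX x · g⁻¹`. [cite: MochizukiEtTh2009, Prop 1.8 p.28] -/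
theorem inclX_conjFun (g : M.GtpC) (x : M.PiTemp) : M.inclX (conjFun g x) = g * M.inclX x * g⁻¹ :=
  MonoidHom.apply_ofInjective_symm M.injective_inclX _

/-- `conjFun g` is continuous (the open-embedding field). [cite: MochizukiEtTh2009, Prop 1.8 p.28] -/
theorem continuous_conjFun (e : M.CLevelData) (g : M.GtpC) : Continuous (conjFun g : M.PiTemp → M.PiTemp) :=
  e.continuous_ofInjective_symm.comp
    (Continuous.subtype_mk (by
      have hc := M.continuous_inclX
      fun_prop) _)

/-- **The inner automorphism of `Π^tp_C` by `g`, restricted to `Π^tp_X`**, as an isomorphism of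
TOPOLOGICAL groups `Π^tp_X ≃ₜ* Π^tp_X` (p. 28: automorphisms "compatible with `Π^tp_{Ẋ☐} → Π^tp_{X☐}`,
`Π^tp_{Ċ☐} → Π^tp_{C☐}`" are handled inside `Π^tp_C`; here the continuity comes from the open-embedding
field). [cite: MochizukiEtTh2009, Prop 1.8 p.28] -/
def conjX (e : M.CLevelData) (g : M.GtpC) : M.PiTemp ≃ₜ* M.PiTemp where
  toFun := conjFun g
  invFun := conjFun g⁻¹
  left_inv x := M.injective_inclX (by rw [inclX_conjFun, inclX_conjFun]; group)
  right_inv x := M.injective_inclX (by rw [inclX_conjFun, inclX_conjFun]; group)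
  map_mul' x y := M.injective_inclX (by rw [map_mul, inclX_conjFun, inclX_conjFun, inclX_conjFun, map_mul]; group)
  continuous_toFun := e.continuous_conjFun g
  continuous_invFun := e.continuous_conjFun g⁻¹

/-- `inclX (conjX g x) = g · inclX x · g⁻¹`. [cite: MochizukiEtTh2009, Prop 1.8 p.28] -/
theorem inclX_conjX (e : M.CLevelData) (g : M.GtpC) (x : M.PiTemp) :
    M.inclX (e.conjX g x) = g * M.inclX x * g⁻¹ :=
  inclX_conjFun g x

/-- For `g = inclX y` the restricted inner automorphism is conjugation by `y`.
[cite: MochizukiEtTh2009, Prop 1.8 p.28] -/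
theorem conjX_inclX (e : M.CLevelData) (y x : M.PiTemp) : e.conjX (M.inclX y) x = y * x * y⁻¹ := by
  apply M.injective_inclX
  rw [e.inclX_conjX, map_mul, map_mul, map_inv]

/-- The image of a subgroup `H ≤ Π^tp_X` under `conjX g`, pushed into `Π^tp_C`, is the conjugate of
`inclX(H)` by `g`. [cite: MochizukiEtTh2009, Prop 1.8 p.28] -/
theorem map_inclX_map_conjX (e : M.CLevelData) (g : M.GtpC) (H : Subgroup M.PiTemp) :
    (H.map (e.conjX g).toMulEquiv.toMonoidHom).map M.inclX =
      (H.map M.inclX).map (MulAut.conj g).toMonoidHom := by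
  rw [Subgroup.map_map, Subgroup.map_map]
  congr 1
  ext x
  change M.inclX (e.conjX g x) = g * M.inclX x * g⁻¹
  exact e.inclX_conjX g x

/-! ### The augmentation on `Π^tp_C` -/

/-- `augC` takes values in `G_K`. [cite: MochizukiEtTh2009, Def 2.1 p.36] -/
theorem augC_mem_GK (e : M.CLevelData) (g : M.GtpC) : e.augC g ∈ M.GK := by
  rw [← e.range_augC]
  exact ⟨g, rfl⟩

/-- **`aug (g x g⁻¹) = augC g · aug x · (augC g)⁻¹`**: the augmentations are compatible with the
restricted inner automorphisms. [cite: MochizukiEtTh2009, Def 2.1 p.36] -/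
theorem aug_conjX (e : M.CLevelData) (g : M.GtpC) (x : M.PiTemp) :
    M.aug (e.conjX g x) = e.augC g * M.aug x * (e.augC g)⁻¹ := by
  rw [← e.augC_inclX, e.inclX_conjX, map_mul, map_mul, map_inv, e.augC_inclX]

/-- `Δ^tp_X` is stable under the restricted inner automorphisms of `Π^tp_C` (`Δ_X ⊴ Π_C`, p. 36).
[cite: MochizukiEtTh2009, Def 2.1 p.36] -/
theorem conjX_mem_deltaTemp_iff (e : M.CLevelData) (g : M.GtpC) (x : M.PiTemp) :
    e.conjX g x ∈ M.DeltaTemp ↔ x ∈ M.DeltaTemp := by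
  change M.aug.toMonoidHom (e.conjX g x) = 1 ↔ M.aug.toMonoidHom x = 1
  change M.aug (e.conjX g x) = 1 ↔ M.aug x = 1
  rw [e.aug_conjX, mul_inv_eq_one, mul_eq_left]

/-- `Δ^tp_X` is carried onto itself by every `conjX g`. [cite: MochizukiEtTh2009, Def 2.1 p.36] -/
theorem map_deltaTemp_conjX (e : M.CLevelData) (g : M.GtpC) :
    M.DeltaTemp.map (e.conjX g).toMulEquiv.toMonoidHom = M.DeltaTemp := by
  ext x
  constructor
  · rintro ⟨y, hy, rfl⟩
    exact (e.conjX_mem_deltaTemp_iff g y).2 hy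
  · intro hx
    refine ⟨(e.conjX g).symm x, (e.conjX_mem_deltaTemp_iff g _).1 ?_, (e.conjX g).apply_symm_apply x⟩
    rw [(e.conjX g).apply_symm_apply]
    exact hx

/-- **A geometric element of `Π^tp_C ∖ Π^tp_X`** (an inversion: "`ι ∈ Δ_C`, an element that lifts the
nontrivial element of `Gal(X/C) ≅ ℤ/2ℤ`", p. 36): `ε_±` (field `epsPM`, not over `X`) corrected by an
element of `Π^tp_X` with the same image in `G_K` (`aug` maps `Π^tp_X` ONTO `G_K`, field `range_aug`).
[cite: MochizukiEtTh2009, Prop 2.2 p.36] -/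
theorem exists_geometric_not_mem_range (e : M.CLevelData) :
    ∃ ι : M.GtpC, ι ∉ M.inclX.range ∧ e.augC ι = 1 := by
  have hmem : e.augC M.epsPM ∈ M.aug.toMonoidHom.range := by
    rw [M.range_aug]
    exact e.augC_mem_GK M.epsPM
  obtain ⟨x, hx⟩ := hmem
  refine ⟨M.epsPM * (M.inclX x)⁻¹, fun h => M.epsPM_not_mem ?_, ?_⟩
  · have h' := M.inclX.range.mul_mem h ⟨x, rfl⟩
    rwa [inv_mul_cancel_right] at h'
  · rw [map_mul, map_inv, e.augC_inclX]
    change e.augC M.epsPM * (M.aug.toMonoidHom x)⁻¹ = 1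
    rw [hx, mul_inv_cancel]

/-! ### `Π^tp_Y` is normal in `Π^tp_C`, granted the printed definition of `Z` (census input P-C7 reduced
to abc-iut-L6-d5's L02 binder) -/

/-- Granted "`Π^tp_Y = Ker(Π^tp_X ↠ Z)` is topologically generated by the compact subgroups of `Π^tp_X`"
(`Thm16Sub.KerToZIsCompactlyGenerated`, the printed definition of `Z` via the dual graph, p. 12), every
restricted inner automorphism of `Π^tp_C` carries `Π^tp_Y` onto itself (compact subgroups go to compact
subgroups — abc-iut-L6-d5's `Thm16Sub.map_GtpY_eq_of_kerToZ`). [cite: MochizukiEtTh2009, Thm 1.6 (i) p.24] -/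
theorem map_GtpY_conjX (e : M.CLevelData) (h : Thm16Sub.KerToZIsCompactlyGenerated M.toThetaSetting) (g : M.GtpC) :
    M.GtpY.map (e.conjX g).toMulEquiv.toMonoidHom = M.GtpY :=
  Thm16Sub.map_GtpY_eq_of_kerToZ (e.conjX g) h h

/-- **`Π^tp_Y` is normal in `Π^tp_C`** ("`Gal(Y/C)`", p. 46; census input P-C7), granted the printed
definition of `Z` (`Thm16Sub.KerToZIsCompactlyGenerated`). [cite: MochizukiEtTh2009, Def 2.5 p.39] -/
theorem map_inclX_GtpY_normal (e : M.CLevelData) (h : Thm16Sub.KerToZIsCompactlyGenerated M.toThetaSetting) :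
    (M.GtpY.map M.inclX).Normal := by
  refine ⟨fun z hz g => ?_⟩
  obtain ⟨y, hy, rfl⟩ := hz
  refine ⟨e.conjX g y, ?_, e.inclX_conjX g y⟩
  have hmem : e.conjX g y ∈ M.GtpY.map (e.conjX g).toMulEquiv.toMonoidHom := ⟨y, hy, rfl⟩
  rwa [e.map_GtpY_conjX h g] at hmem

end CLevelData

end MuTwoSetting

end Literature.AnabelianGeometry.EtaleTheta

end
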